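import Literature.IUT.LogThetaLattice.GlobalLGPFrobenioidsRealifiedFrobenioid
import Literature.AlgebraicGeometry.Frobenioids.RealificationModelRow
import HarnessLib

/-!
# [IUTchIII] Proposition 3.7 (ii)/(v) «(†𝓕⊛_𝔪𝔬𝔡)_α → (†𝓕⊛ℝ_𝔪𝔬𝔡)_α», E: the realification functor IS [FrdI] Prop. 5.3's
# "functor that arises naturally from the construction of the realification", in the model descriptions

abc-iut cell, layer L6, wave-5 seat abc-iut-w5-d153 (gen 2); part E of the lineage RealifiedRatFn (A) / RealifiedModel
(B: `Prop37.realification : Ffrak F ⥤ FrakRlfCat F`) / RealifiedFrobenioid (C: `FrakRlfCat.toModel : FrakRlfCat F ≌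
ModelFrobenioid(𝒟, Φ^rlf, ℝ · Φ^birat)`) / RealifiedPrimes (D).

PRINT. [IUTchIII] Prop. 3.7 (v) p. 112 l. 2–4 "the products of the realification functors
`∏ (†𝓕⊛_𝔪𝔬𝔡)_j → ∏ (†𝓕⊛ℝ_𝔪𝔬𝔡)_j` [cf. [FrdI], Proposition 5.3]" [claim key Mochizuki2012, status disputed (D-0012)];
[FrdI] Prop. 5.3 p. 103: "there is a natural 1-commutative diagram of functors … `C^un-tr → (C^un-tr)^pf → C^rlf` …
the remaining functors are the functors that arise naturally from the construction of the 'unit-trivialization',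
'perfection', and 'realification'"; Prop. 5.5 (iv) p. 104 (the data `Φ^rlf, ℝ · Φ^birat, ℝ · Φ^birat ↪ (Φ^rlf)^gp`)
[cite: MochizukiFrdI2008, Prop. 5.3 p.103] [cite: MochizukiFrdI2008, Prop. 5.5 (iv) p.104].

Layer L1 makes "arise naturally from the construction" precise for model Frobenioids (abc-iut-L1-t5 / L1-d2,
`ModelFrobenioidMap.lean`): a MORPHISM OF MODEL DATA `(Φ, 𝔹, Div_𝔹) → (Φ', 𝔹', Div_𝔹')` (`ModelFrobenioid.DataHom`:
`η : Φ → Φ'`, `β : 𝔹 → 𝔹'`, `Div_𝔹' ∘ β = η^gp ∘ Div_𝔹`) induces the functor `DataHom.functor`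
`(A, α) ↦ (A, η^gp(α))`, `(d, f, Div, u) ↦ (d, f, η(Div), β(u))`; the realification row is the data morphism
`(Φ, Φ^birat) → (Φ^rlf, ℝ · Φ^birat)` (`RealificationData.ofBaseData`, `toRlfModel`).

CONTENTS (ns `Literature.IUT.LogThetaLattice.Prop37.FrakRlfCat`), at the model of record for `(†𝓕⊛_𝔪𝔬𝔡)_α = Ffrak F`
(abc-iut-w4-d005: INTEGRAL families, [FrdI] data `(Φmod, F^×, β)` with `Prop37.modelHyps`, comparison equivalence
`GlobalFrobenioidModels.toModel` of abc-iut-L6-t6) and its realification (parts B/C):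
* `etaHom` / `eta : Φ → Φ^rlf` (abc-iut-w4-d005's `realifyObjHom` on effective families — an integral effective family
  IS a real one), `betaRlfHom` / `betaRlf : F^×_mod → ℝ · Φ^birat` (`f ↦ Div(f)`, part A's `prinFamily`), and
  **`rlfDataHom : ModelFrobenioid.DataHom (divBmod (Prop37.modelHyps F)) (divBRlf F)`** — the compatibility
  `Div_𝔹'(Div f) = η^gp(Div_𝔹(f))` is abc-iut-w4-d005's `realifyObj_betaDiv` ("principal families correspond");
  `gpApp_eta_toGp` (`η^gp` on classes of families is `realifyObjHom`);
* **`realificationIso : GlobalFrobenioidModels.toModel (modelHyps F) ⋙ rlfDataHom.functor ≅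
  Prop37.realification F ⋙ FrakRlfCat.toModel F`** — 1-COMMUTATIVITY: through the comparison equivalences of
  `(†𝓕⊛_𝔪𝔬𝔡)_α` (abc-iut-L6-t6/w4-d005) and of `(†𝓕⊛ℝ_𝔪𝔬𝔡)_α` (part C) with their [FrdI] Thm. 5.2 model Frobenioids, part
  B's realification functor IS the functor of model Frobenioids induced by the data morphism
  `(Φ, F^×, β) → (Φ^rlf, ℝ · Φ^birat, incl)` (components `(1, id, 0, 0)`, abc-iut-L1-d2's `ModelFrobenioid.isoOfClsEq`;
  on morphisms the two functors agree on the nose: `realificationIso_map_degFr/_div/_unit`).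
RESIDUAL as in part C (THE canonical `RealificationData.canonical` of layer L1 vs the model's `Φ^rlf`; L1-sized).
No `Prop`-valued definition; nothing here asserts a disputed claim or takes a side on [IUTchIII] Cor. 3.12;
typed ≠ discharged; instantiated ≠ endorsed.
-/

noncomputable section

namespace Literature.IUT.LogThetaLattice

namespace Prop37

namespace FrakRlfCat

open CategoryTheory Opposite NumberField GlobalFrobenioidModels Literature.AlgebraicGeometry.Frobenioids
open Literature.AlgebraicGeometry.Frobenioids (Places)

variable (F : Type) [Field F] [NumberField F]

/-! ### The data morphism `(Φ, F^×_mod, β) → (Φ^rlf, ℝ · Φ^birat, incl)` -/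

/-- `η : Φ(∗) → Φ^rlf(∗)` additively: an INTEGRAL effective family is a REAL effective family (abc-iut-w4-d005's
`realifyObjHom`, effectivity by `realifyObj_mem_effDiv_iff`). [cite: MochizukiFrdI2008, Prop. 5.3 p.103] -/
def etaAddHom : effDiv (Places F) (Gamma F) (nonneg F) →+ effDiv (ModelPlaces F) (fun _ => ℝ) nonnegModel where
  toFun D := ⟨realifyObjHom F (D : FrakObj (Places F) (Gamma F)),
    (realifyObj_mem_effDiv_iff F (D : FrakObj (Places F) (Gamma F))).mpr D.2⟩
  map_zero' := Subtype.ext (map_zero (realifyObjHom F))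
  map_add' D E := Subtype.ext (map_add (realifyObjHom F) (D : FrakObj (Places F) (Gamma F)) E)

/-- The family underlying `etaAddHom D` is `realifyObjHom D`. [cite: MochizukiFrdI2008, Prop. 5.3 p.103] -/
@[simp] theorem coe_etaAddHom (D : effDiv (Places F) (Gamma F) (nonneg F)) :
    ((etaAddHom F D : effDiv (ModelPlaces F) (fun _ => ℝ) nonnegModel) : ModelFrakObj F) =
      realifyObjHom F (D : FrakObj (Places F) (Gamma F)) := rfl

/-- `η : Φ(∗) → Φ^rlf(∗)` in the multiplicative rendering of the [FrdI] files. [cite: MochizukiFrdI2008, Prop. 5.3 p.103] -/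
def etaHom : EffDiv (Places F) (Gamma F) (nonneg F) →* EffDiv (ModelPlaces F) (fun _ => ℝ) nonnegModel :=
  AddMonoidHom.toMultiplicative (etaAddHom F)

/-- **`η : Φ → Φ^rlf`** as a homomorphism of (constant) monoids on the one-arrow base ([FrdI] Def. 2.4 (i)(c) / Prop.
5.3: the natural map from the divisor monoid to its realification; at the model: `ℤ ↪ ℝ` at finite places,
identity at archimedean ones). [cite: MochizukiFrdI2008, Prop. 5.3 p.103] -/
def eta : Φmod (Places F) (Gamma F) (nonneg F) ⟶ PhiRlf F where
  app _ := CommMonCat.ofHom (etaHom F)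
  naturality X Y f := by
    apply CommMonCat.hom_ext
    refine MonoidHom.ext fun u => ?_
    rfl

/-- `η` at the unique object is `etaHom`. [cite: MochizukiFrdI2008, Prop. 5.3 p.103] -/
theorem eta_app_hom (u : EffDiv (Places F) (Gamma F) (nonneg F)) : ((eta F).app (op pt)).hom u = etaHom F u := rfl

/-- **`β : F^×_mod → ℝ · Φ^birat`, `f ↦ Div(f)`**: the rational function monoid of `(†𝓕⊛_𝔪𝔬𝔡)_α` maps to that of the
realification through its (principal) divisor (part A's `prinFamily`, `prinFamily_mem_realRatFn`); torsion `μ(F)`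
dies (part A's `prinFamily_neg_one`). [cite: MochizukiFrdI2008, Prop. 5.3 p.103] -/
def betaRlfHom : Fˣ →* Multiplicative (realRatFn F) where
  toFun f := Multiplicative.ofAdd ⟨prinFamily F f, prinFamily_mem_realRatFn F f⟩
  map_one' := by
    apply Multiplicative.toAdd.injective
    apply Subtype.ext
    show prinFamily F 1 = 0
    exact prinFamily_one F
  map_mul' f g := by
    apply Multiplicative.toAdd.injective
    apply Subtype.ext
    show prinFamily F (f * g) = prinFamily F f + prinFamily F g
    exact prinFamily_mul F f g

/-- The family underlying `betaRlfHom f` is `Div(f)`. [cite: MochizukiFrdI2008, Prop. 5.3 p.103] -/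
@[simp] theorem coe_toAdd_betaRlfHom (f : Fˣ) :
    ((Multiplicative.toAdd (betaRlfHom F f) : realRatFn F) : ModelFrakObj F) = prinFamily F f := rfl

/-- **`β : F^×_mod → ℝ · Φ^birat`** as a homomorphism of (constant) monoids on the one-arrow base.
[cite: MochizukiFrdI2008, Prop. 5.3 p.103] -/
def betaRlf : Bmod F ⟶ BRlf F where
  app _ := CommMonCat.ofHom (betaRlfHom F)
  naturality X Y f := by
    apply CommMonCat.hom_ext
    refine MonoidHom.ext fun u => ?_
    rfl

/-- `β` at the unique object is `betaRlfHom`. [cite: MochizukiFrdI2008, Prop. 5.3 p.103] -/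
theorem betaRlf_app_hom (f : Fˣ) : ((betaRlf F).app (op pt)).hom f = betaRlfHom F f := rfl

/-- `η^gp` on the class of an EFFECTIVE integral family is the class of its realification.
[cite: MochizukiFrdI2008, Prop. 5.3 p.103] -/
theorem gpApp_eta_of (a : effDiv (Places F) (Gamma F) (nonneg F)) :
    gpApp (eta F) (op pt) (Algebra.GrothendieckGroup.of (Multiplicative.ofAdd a)) =
      Algebra.GrothendieckGroup.of (Multiplicative.ofAdd (etaAddHom F a)) :=
  gpApp_of (eta F) (op pt) _

/-- **`η^gp` on the class of an (integral) family is the class of its realification** (`[D] = [D⁺] − [D⁻]`):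
through abc-iut-L6-t6's identifications `toGp` of families with elements of the groupifications,
`η^gp : Φ^gp(∗) → (Φ^rlf)^gp(∗)` IS abc-iut-w4-d005's additive `realifyObjHom` (`ℤ ↪ ℝ` at finite places).
[cite: MochizukiFrdI2008, Prop. 5.3 p.103] -/
theorem gpApp_eta_toGp (D : FrakObj (Places F) (Gamma F)) :
    gpApp (eta F) (op pt) (toGp (Prop37.modelHyps F) (Multiplicative.ofAdd D)) =
      toGp (modelHyps_places F) (Multiplicative.ofAdd (realifyObjHom F D)) := by
  have h1 : gpApp (eta F) (op pt) (toGp (Prop37.modelHyps F) (Multiplicative.ofAdd D)) =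
      gpApp (eta F) (op pt) (Algebra.GrothendieckGroup.of (Multiplicative.ofAdd
          (⟨posPart (Prop37.modelHyps F) D, posPart_mem (Prop37.modelHyps F) D⟩ :
            effDiv (Places F) (Gamma F) (nonneg F)))) /
        gpApp (eta F) (op pt) (Algebra.GrothendieckGroup.of (Multiplicative.ofAdd
          (⟨negPart (Prop37.modelHyps F) D, negPart_mem (Prop37.modelHyps F) D⟩ :
            effDiv (Places F) (Gamma F) (nonneg F)))) := by
    rw [← map_div]
    rfl
  rw [h1, gpApp_eta_of, gpApp_eta_of, toGp_ofAdd,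
    toGpFun_eq_div (modelHyps_places F) (realifyObjHom F D)
      ((realifyObj_mem_effDiv_iff F _).mpr (posPart_mem (Prop37.modelHyps F) D))
      ((realifyObj_mem_effDiv_iff F _).mpr (negPart_mem (Prop37.modelHyps F) D))
      (by
        show realifyObjHom F _ - realifyObjHom F _ = _
        rw [← map_sub, GlobalFrobenioidModels.posPart_sub_negPart])]
  rfl

/-- **The data morphism `(Φ, F^×_mod, β) → (Φ^rlf, ℝ · Φ^birat, incl)` of the realification of `(†𝓕⊛_𝔪𝔬𝔡)_α`**
(layer L1's `ModelFrobenioid.DataHom`; the shape of `RealificationData.ofBaseData` for `Ψ = Φ^birat =` image of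
`Div_𝔹`): the compatibility `incl(Div f) = η^gp(β(f))` is "principal families correspond" (abc-iut-w4-d005's
`realifyObj_betaDiv`). [cite: MochizukiFrdI2008, Prop. 5.5 (iv) p.104] -/
def rlfDataHom : ModelFrobenioid.DataHom (divBmod (Prop37.modelHyps F)) (divBRlf F) where
  η := eta F
  β := betaRlf F
  comm A u := by
    obtain ⟨⟨⟨⟩⟩⟩ := A
    show gpApp (eta F) (op pt) (toGp (Prop37.modelHyps F)
        (Multiplicative.ofAdd (Multiplicative.toAdd (betaDiv (Prop37.modelHyps F) u)))) =
      toGp (modelHyps_places F) (Multiplicative.ofAdd (prinFamily F u))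
    rw [gpApp_eta_toGp, realifyObjHom_apply, realifyObj_betaDiv]

/-- `rlfDataHom.η = eta`. [cite: MochizukiFrdI2008, Prop. 5.5 (iv) p.104] -/
@[simp] theorem rlfDataHom_η : (rlfDataHom F).η = eta F := rfl

/-- `rlfDataHom.β = betaRlf`. [cite: MochizukiFrdI2008, Prop. 5.5 (iv) p.104] -/
@[simp] theorem rlfDataHom_β : (rlfDataHom F).β = betaRlf F := rfl

/-- **"The functor that arises naturally from the construction of the realification"** ([FrdI] Prop. 5.3) for
`(†𝓕⊛_𝔪𝔬𝔡)_α`, in the model descriptions: the functor of [FrdI] Thm. 5.2 model Frobenioids induced by `rlfDataHom`,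
`(∗, α) ↦ (∗, η^gp(α))`, `(d, id, Div, f) ↦ (d, id, η(Div), Div(f))` (layer L1's `DataHom.functor`).
[cite: MochizukiFrdI2008, Prop. 5.3 p.103] -/
abbrev rlfModelFunctor : FrakModel (Prop37.modelHyps F) ⥤ RlfModel F := (rlfDataHom F).functor

/-! ### 1-commutativity with the comparison equivalences: part B's `realification` IS that functor -/

/-- The two routes `(†𝓕⊛_𝔪𝔬𝔡)_α → ModelFrobenioid(𝒟, Φ^rlf, ℝ · Φ^birat)` agree on the classes of objects:
`η^gp(−[𝔍]) = −[𝔍^rlf]`. [cite: MochizukiFrdI2008, Prop. 5.3 p.103] -/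
theorem realification_obj_cls_eq (X : Ffrak F) :
    ((GlobalFrobenioidModels.toModel (Prop37.modelHyps F) ⋙ rlfModelFunctor F).obj X).cls =
      ((realification F ⋙ toModel F).obj X).cls := by
  show gpApp (eta F) (op pt) (toGp (Prop37.modelHyps F) (Multiplicative.ofAdd (-X.obj))) =
    toGp (modelHyps_places F) (Multiplicative.ofAdd (-(realifyObj F X.obj)))
  rw [gpApp_eta_toGp, map_neg, realifyObjHom_apply]

/-- … and on the Frobenius degree of a morphism (`n ↦ n` both ways). [cite: MochizukiFrdI2008, Prop. 5.3 p.103] -/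
theorem realification_map_degFr_eq {X Y : Ffrak F} (φ : X ⟶ Y) :
    ModelFrobenioid.Hom.degFr ((GlobalFrobenioidModels.toModel (Prop37.modelHyps F) ⋙ rlfModelFunctor F).map φ) =
      ModelFrobenioid.Hom.degFr ((realification F ⋙ toModel F).map φ) := rfl

/-- … and on the unit of a morphism (`f ↦ Div(f)` both ways). [cite: MochizukiFrdI2008, Prop. 5.3 p.103] -/
theorem realification_map_unit_eq {X Y : Ffrak F} (φ : X ⟶ Y) :
    ModelFrobenioid.Hom.unit ((GlobalFrobenioidModels.toModel (Prop37.modelHyps F) ⋙ rlfModelFunctor F).map φ) =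
      ModelFrobenioid.Hom.unit ((realification F ⋙ toModel F).map φ) := by
  apply Multiplicative.toAdd.injective
  apply Subtype.ext
  rfl

/-- … and on the zero divisor of a morphism: `η(Div(f) + n•𝔍₁ − 𝔍₂) = Div(f)^rlf + n•𝔍₁^rlf − 𝔍₂^rlf` (additivity of
`realifyObjHom` and "principal families correspond"). [cite: MochizukiFrdI2008, Prop. 5.3 p.103] -/
theorem realification_map_div_eq {X Y : Ffrak F} (φ : X ⟶ Y) :
    ModelFrobenioid.Hom.div ((GlobalFrobenioidModels.toModel (Prop37.modelHyps F) ⋙ rlfModelFunctor F).map φ) =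
      ModelFrobenioid.Hom.div ((realification F ⋙ toModel F).map φ) := by
  show etaHom F (GlobalFrobenioidModels.homDiv (Prop37.modelHyps F) φ) = homDiv ((realification F).map φ)
  apply Multiplicative.toAdd.injective
  apply Subtype.ext
  show realifyObjHom F ((Multiplicative.toAdd (GlobalFrobenioidModels.homDiv (Prop37.modelHyps F) φ) :
      effDiv (Places F) (Gamma F) (nonneg F)) : FrakObj (Places F) (Gamma F)) =
    prinFamily F (FrakCat.fn φ) + (FrakCat.deg φ : ℕ) • realifyObj F X.obj - realifyObj F Y.obj
  rw [GlobalFrobenioidModels.coe_homDiv, map_sub, map_add, map_zsmul, natCast_zsmul, realifyObjHom_apply,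
    realifyObjHom_apply, realifyObjHom_apply, realifyObj_betaDiv]

/-- **1-COMMUTATIVITY: part B's realification functor `(†𝓕⊛_𝔪𝔬𝔡)_α → (†𝓕⊛ℝ_𝔪𝔬𝔡)_α` IS [FrdI] Prop. 5.3's natural
functor in the model descriptions** — the square formed by abc-iut-L6-t6/w4-d005's comparison equivalence
`(†𝓕⊛_𝔪𝔬𝔡)_α ≌ ModelFrobenioid(𝒟, Φ, F^×_mod)`, part C's `(†𝓕⊛ℝ_𝔪𝔬𝔡)_α ≌ ModelFrobenioid(𝒟, Φ^rlf, ℝ · Φ^birat)`, part B's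
`Prop37.realification` and layer L1's `DataHom.functor` of `rlfDataHom` commutes up to the natural isomorphism
with components `(1, id, 0, 0)` (abc-iut-L1-d2's `ModelFrobenioid.isoOfClsEq`; on morphisms the functors agree on
the nose). [cite: MochizukiFrdI2008, Prop. 5.3 p.103] -/
def realificationIso :
    GlobalFrobenioidModels.toModel (Prop37.modelHyps F) ⋙ rlfModelFunctor F ≅ realification F ⋙ toModel F :=
  NatIso.ofComponents (fun X => ModelFrobenioid.isoOfClsEq (realification_obj_cls_eq F X)) (fun {X Y} φ => by
    apply ModelFrobenioid.hom_ext
    · show ModelFrobenioid.degFr (_ ≫ ModelFrobenioid.homOfClsEq (realification_obj_cls_eq F Y)) =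
        ModelFrobenioid.degFr (ModelFrobenioid.homOfClsEq (realification_obj_cls_eq F X) ≫ _)
      rw [ModelFrobenioid.degFr_comp, ModelFrobenioid.degFr_comp, ModelFrobenioid.degFr_homOfClsEq,
        ModelFrobenioid.degFr_homOfClsEq, one_mul, mul_one]
      rfl
    · exact Subsingleton.elim _ _
    · show ModelFrobenioid.div (_ ≫ ModelFrobenioid.homOfClsEq (realification_obj_cls_eq F Y)) =
        ModelFrobenioid.div (ModelFrobenioid.homOfClsEq (realification_obj_cls_eq F X) ≫ _)
      rw [ModelFrobenioid.div_comp, ModelFrobenioid.div_comp, ModelFrobenioid.div_homOfClsEq,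
        ModelFrobenioid.div_homOfClsEq, map_one, one_mul, one_pow, mul_one, ModelFrobenioid.degFr_homOfClsEq,
        PNat.one_coe, pow_one, ModelFrobenioid.baseMap_homOfClsEq, op_id, CategoryTheory.Functor.map_id,
        CommMonCat.hom_id, MonoidHom.id_apply]
      exact realification_map_div_eq F φ
    · show ModelFrobenioid.unit (_ ≫ ModelFrobenioid.homOfClsEq (realification_obj_cls_eq F Y)) =
        ModelFrobenioid.unit (ModelFrobenioid.homOfClsEq (realification_obj_cls_eq F X) ≫ _)
      rw [ModelFrobenioid.unit_comp, ModelFrobenioid.unit_comp, ModelFrobenioid.unit_homOfClsEq,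
        ModelFrobenioid.unit_homOfClsEq, map_one, one_mul, one_pow, mul_one, ModelFrobenioid.degFr_homOfClsEq,
        PNat.one_coe, pow_one, ModelFrobenioid.baseMap_homOfClsEq, op_id, CategoryTheory.Functor.map_id,
        CommMonCat.hom_id, MonoidHom.id_apply]
      exact realification_map_unit_eq F φ)

/-- The components of `realificationIso` are the isomorphisms `(1, id, 0, 0)`: Frobenius degree `1`.
[cite: MochizukiFrdI2008, Prop. 5.3 p.103] -/
@[simp] theorem degFr_realificationIso_hom_app (X : Ffrak F) :
    ModelFrobenioid.degFr ((realificationIso F).hom.app X) = 1 := rfl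

/-- **Compatibility with the structure functors to `F_{Φ^rlf}`** ([FrdI] Prop. 5.3: the realification functor lies
over the map of elementary Frobenioids induced by `Φ → Φ^rlf`): layer L1's `DataHom.functorCompToElem` for
`rlfDataHom`, i.e. `rlfModelFunctor ⋙ toElem(Φ^rlf) ≅ toElem(Φ) ⋙ F_η`. [cite: MochizukiFrdI2008, Prop. 5.3 p.103] -/
def rlfModelFunctorCompToElem :
    rlfModelFunctor F ⋙ ModelFrobenioid.toElem (PhiRlf F) (BRlf F) (divBRlf F) ≅
      ModelFrobenioid.toElem (Φmod (Places F) (Gamma F) (nonneg F)) (Bmod F) (divBmod (Prop37.modelHyps F)) ⋙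
        ElemFrobenioid.mapNatTrans (eta F) :=
  (rlfDataHom F).functorCompToElem

end FrakRlfCat

end Prop37

end Literature.IUT.LogThetaLattice

end
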